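import Literature.NumberTheory.GaloisRepresentations.GaloisCohomology
import HarnessLib

/-!
# `(s, t) ↦ e(s, t^τ)`: the symmetric `Γ_K`-`τ`-equivariant form attached to an alternating Galois-equivariant
# `μₙ`-valued pairing and a complex conjugation (Howard 2004, Remark 1.3.2), in `ℤ/n`-valued form

Topic `NumberTheory/EllipticCurves`; pure algebra over the tree's discrete-Galois-module layer; one definition with
body (`conjPairing`) and theorems; no named fact, no instance, no notation, no `sorry`.

Howard 2004, Rem. 1.3.2 (arXiv Rem. 2.3.2): «If `R = ℤ_p`, `T` is the `p`-adic Tate module of an elliptic curve over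
`ℚ`, and `e : T × T → ℤ_p(1)` is the Weil pairing, then the pairing `(s, t) = e(s, t^τ)` has the desired properties»
(H.4: perfect, symmetric, `(s^σ, t^{τστ⁻¹}) = (s, t)^σ`). This file proves exactly that, one finite level at a
time and abstractly: given

* a bi-additive `Γ_K`-equivariant `e : M × M → μₙ` (`e(g a, g b) = g · e(a, b)`) which is ALTERNATING in the sense
  `e(b, a) = −e(a, b)` (additive notation for `μₙ`),
* an additive `θ : M → M` (the action of a complex conjugation `τ`) with `θ ∘ θ = id`,
  `θ(ρ(τ g τ⁻¹) a) = ρ(g)(θ a)` for a map `c = (g ↦ τ g τ⁻¹)`, and `e(θ a, θ b) = −e(a, b)` (`τ` acts on `μₙ` by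
  inversion),
* a trivialisation `log : μₙ → ℤ/n` (choice of a primitive root) with `log(g · ξ) = χ̄(g) · log ξ`,

the form **`conjPairing e θ log : M × M → ℤ/n`, `(a, b) ↦ log e(a, θ b)`** is SYMMETRIC (`conjPairing_symm`), satisfies
**`ẽ(ρ g a, ρ (c g) b) = χ̄(g) · ẽ(a, b)`** (`conjPairing_equivariant`), is left-non-degenerate when `e` is and `log` is
injective (`conjPairing_left_nondegenerate`), and exhausts `Hom(M, ℤ/n)` when `e` exhausts `Hom(M, μₙ)` and `log` is
bijective (`conjPairing_left_exhausting`) — precisely the `E`-level input (`ẽ`, with these four properties) of the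
cell's `ZpExtensionEisensteinTwistDualityForm` (`eisensteinDualityForm_symm/_bijective/_equivariant`), i.e. of
hypothesis H.4 for Howard's `T_𝔮 = T_pE ⊗ S_𝔮(ψ)`. Instantiation (`M = E[p^k]`, `e` = Weil pairing, `θ` = a complex
conjugation on `E(K̄)[p^k]`, `log` from a primitive `p^k`-th root of unity) is left to the consumer, as for the tree's
abstract Weil-pairing files (`WeilPairingTateDual`, `KummerImageIsotropy`). BSD is not proved by any of this.

References: [Howard2004HeegnerKolyvagin] B. Howard, Compositio Math. 140 (2004), §1.3, H.4 and Rem. 1.3.2 (arXiv:1202.6340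
p. 7, L69–90 and L81–88); [SilvermanAEC2009] III.8.1 (Weil pairing: bilinear, alternating, Galois-equivariant).
-/

noncomputable section

universe u

namespace Literature.NumberTheory.EllipticCurves

open Literature.NumberTheory.GaloisRepresentations Field

variable {K : Type u} [Field K] {M : Type u} [AddCommGroup M] [TopologicalSpace M] [DiscreteTopology M]
  (ρ : DiscreteGaloisModule K M) {n : ℕ}
  (e : M →+ M →+ DiscreteGaloisModule.MuCarrier K n) (θ : M →+ M) (log : DiscreteGaloisModule.MuCarrier K n →+ ZMod n)

/-- **`ẽ(a, b) = log e(a, θ b)`** — Howard's `(s, t) = e(s, t^τ)` read through a trivialisation `log : μₙ → ℤ/n`.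
[cite: Howard2004HeegnerKolyvagin, Rem. 1.3.2 (arXiv Rem. 2.3.2, p. 7 L81–88)] -/
def conjPairing : M →+ M →+ ZMod n :=
  (e.compl₂ θ).compr₂ log

omit [TopologicalSpace M] [DiscreteTopology M] in
/-- Unfolding: `conjPairing e θ log a b = log (e a (θ b))`. [cite: Howard2004HeegnerKolyvagin, Rem. 1.3.2] -/
@[simp]
theorem conjPairing_apply (a b : M) : conjPairing e θ log a b = log (e a (θ b)) := rfl

omit [TopologicalSpace M] [DiscreteTopology M] in
/-- **Symmetry**: `ẽ(a, b) = ẽ(b, a)` for `e` alternating, `θ` an involution with `e(θ a, θ b) = −e(a, b)` —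
«the pairing `(s,t) = e(s, t^τ)` … is symmetric». [cite: Howard2004HeegnerKolyvagin, Rem. 1.3.2 and H.4 («symmetric»)] -/
theorem conjPairing_symm (halt : ∀ a b : M, e b a = -e a b) (hθθ : ∀ a : M, θ (θ a) = a)
    (hθe : ∀ a b : M, e (θ a) (θ b) = -e a b) (a b : M) :
    conjPairing e θ log a b = conjPairing e θ log b a := by
  rw [conjPairing_apply, conjPairing_apply, halt (θ a) b]
  congr 1
  rw [show e (θ a) b = e (θ a) (θ (θ b)) by rw [hθθ], hθe, neg_neg]

/-- **Equivariance**: `ẽ(ρ g a, ρ (c g) b) = χ̄(g) · ẽ(a, b)` — Howard's `(s^σ, t^{τστ⁻¹}) = (s, t)^σ` — for `e`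
`Γ_K`-equivariant, `θ ∘ ρ(c g) = ρ(g) ∘ θ` and `log(g · ξ) = χ̄(g) log ξ`.
[cite: Howard2004HeegnerKolyvagin, H.4 (arXiv p. 7, L74–77) and Rem. 1.3.2] -/
theorem conjPairing_equivariant (c : absoluteGaloisGroup K → absoluteGaloisGroup K) (χbar : absoluteGaloisGroup K → ZMod n)
    (he : ∀ (g : absoluteGaloisGroup K) (a b : M), e (ρ g a) (ρ g b) = DiscreteGaloisModule.mu K n g (e a b))
    (hθ : ∀ (g : absoluteGaloisGroup K) (a : M), θ (ρ (c g) a) = ρ g (θ a))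
    (hlog : ∀ (g : absoluteGaloisGroup K) (ξ : DiscreteGaloisModule.MuCarrier K n),
      log (DiscreteGaloisModule.mu K n g ξ) = χbar g * log ξ)
    (g : absoluteGaloisGroup K) (a b : M) :
    conjPairing e θ log (ρ g a) (ρ (c g) b) = χbar g * conjPairing e θ log a b := by
  rw [conjPairing_apply, conjPairing_apply, hθ, he, hlog]

omit [TopologicalSpace M] [DiscreteTopology M] in
/-- **Left non-degeneracy**: if `e(a, ·) = 0 ⇒ a = 0`, `θ` is an involution and `log` is injective, then
`ẽ(a, ·) = 0 ⇒ a = 0`. [cite: Howard2004HeegnerKolyvagin, H.4 («perfect») and Rem. 1.3.2] -/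
theorem conjPairing_left_nondegenerate (hnd : ∀ a : M, (∀ b : M, e a b = 0) → a = 0) (hθθ : ∀ a : M, θ (θ a) = a)
    (hlog : Function.Injective log) (a : M) (ha : ∀ b : M, conjPairing e θ log a b = 0) : a = 0 := by
  refine hnd a fun b => hlog ?_
  rw [map_zero, ← hθθ b]
  exact ha (θ b)

omit [TopologicalSpace M] [DiscreteTopology M] in
/-- **Exhaustion of characters**: if every `ψ : M → μₙ` is `e(w, ·)`, `θ` is an involution and `log` is bijective, then
every `φ : M → ℤ/n` is `ẽ(w, ·)`. [cite: Howard2004HeegnerKolyvagin, H.4 («perfect») and Rem. 1.3.2] -/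
theorem conjPairing_left_exhausting (hex : ∀ ψ : M →+ DiscreteGaloisModule.MuCarrier K n, ∃ w : M, ∀ b : M, e w b = ψ b)
    (hθθ : ∀ a : M, θ (θ a) = a) (hlog : Function.Bijective log) (φ : M →+ ZMod n) :
    ∃ w : M, ∀ b : M, conjPairing e θ log w b = φ b := by
  let L : DiscreteGaloisModule.MuCarrier K n ≃+ ZMod n := AddEquiv.ofBijective log hlog
  obtain ⟨w, hw⟩ := hex ((L.symm : ZMod n →+ DiscreteGaloisModule.MuCarrier K n).comp (φ.comp θ))
  refine ⟨w, fun b => ?_⟩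
  rw [conjPairing_apply, hw]
  change L (L.symm (φ (θ (θ b)))) = φ b
  rw [AddEquiv.apply_symm_apply, hθθ]

omit [TopologicalSpace M] [DiscreteTopology M] in
/-- Right versions follow from symmetry: `ẽ(·, b) = 0 ⇒ b = 0`. [cite: Howard2004HeegnerKolyvagin, H.4 («perfect»)] -/
theorem conjPairing_right_nondegenerate (halt : ∀ a b : M, e b a = -e a b) (hθθ : ∀ a : M, θ (θ a) = a)
    (hθe : ∀ a b : M, e (θ a) (θ b) = -e a b) (hnd : ∀ a : M, (∀ b : M, e a b = 0) → a = 0)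
    (hlog : Function.Injective log) (b : M) (hb : ∀ a : M, conjPairing e θ log a b = 0) : b = 0 :=
  conjPairing_left_nondegenerate e θ log hnd hθθ hlog b fun a => by
    rw [conjPairing_symm e θ log halt hθθ hθe]; exact hb a

end Literature.NumberTheory.EllipticCurves
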